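import Literature.MathematicalPhysics.QuantumFieldTheory.BalabanImbrieJaffe1984to88.BIJ85Ineq722DeltaA
import Literature.MathematicalPhysics.QuantumFieldTheory.Balaban1983to89.B5Eq147TorusBridge
import Literature.MathematicalPhysics.QuantumFieldTheory.Balaban1983to89.B5Hk163Form166
import Literature.MathematicalPhysics.QuantumFieldTheory.Balaban1983to89.B5RealFields
import Literature.MathematicalPhysics.QuantumFieldTheory.BalabanImbrieJaffe1984to88.BIJ85Prop511Torus

/-!
# `BalabanImbrieJaffe1984to88.BIJ85Eq721MinimizerKernel` — T. Bałaban, J. Imbrie, A. Jaffe, *Renormalization of the Higgs model: minimizers,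
propagators and the stability of mean field theory*, Commun. Math. Phys. **97** (1985) 299–329 [BalabanImbrieJaffe1985], Sect. 7.2 p. 325,
**(7.2.1) «The minimizer H_k can be expressed as an integral kernel»** — file 5 of row C1.Eq7.2.1-7.2.2: THE KERNEL `H_{k,μν}(x; y)` of the
row's torus instance for the printed `G = Δ_a⁻¹` (file 4 `BIJ85Ineq722DeltaA`, for which (7.2.2) `KernelData.Ineq722` is proved given only [6I]
Proposition 1.2) IS THE INTEGRAL KERNEL OF THE LANDAU GAUGE MINIMIZER `H_k` of (4.4.2) p. 312 — the Faddeev–Popov mean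
`H_kB = Z_k(B)⁻¹∫𝒟A δ(Q_kA − B)𝒢(∂*A) A e^{−½‖∂A‖²}` of [BalabanImbrieJaffe1985] on the V1 lattice calculus (`BIJ85LandauMinimizer442.Hk`,
instance `BIJ85LandauMinimizer442V1.opsV1`) — and of Bałaban's closed-form operator (1.63) = (1.103) `GQ^*(QGQ^*)⁻¹` of [6I] on the torus
(`B5Hk163Torus.HkOp` = `Beta.FluctuationProjection.Hk`).

statement-level skeleton of published theorems with citation tags; proofs where landed; nothing here is a claim about the Yang–Mills mass gap

PDF held: `paper:balaban1985-cmp97-bij-higgs-minimizers` (journal page = PDF page + 298; p. 312 = PDF 14, p. 325 = PDF 27; text layers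
`~/.lit/texts/paper-balaban1985-cmp97-bij-higgs-minimizers/p0014.txt`, `p0027.txt` read this session) and `paper:balaban1984-cmp95-propagators-rt-i`
([6I] = [Balaban1984PropagatorsI]; journal page = PDF page + 16).

THE PRINTED TEXT (verbatim).  [BalabanImbrieJaffe1985] p. 325: *"7.2. Regularity and Decay of Propagators and Minimizers. We are interested in
Landau gauge propagators and minimizers, because they have good regularity and decay. The key objects are H_k and C^{(k)}, while estimates on
𝒢_k follow by (4.4.4). The minimizer H_k can be expressed as an integral kernel. For x ∈ T_η, (H_kB)_μ(x) = Σ_{y∈T₁^{(k)},ν} H_{k,μν}(x; y)B_ν(y).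
(7.2.1) The kernel H_{k,μν}(x,y) and its gradient decay exponentially. … (7.2.2) This inequality is a consequence of Proposition 1.2 and the
representation (1.103) of [6I]."*  p. 312: *"Such a Faddeev-Popov type choice leads to the formula for the Landau gauge minimizer H_kB =
Z_k(B)⁻¹∫𝒟A δ(Q_kA − B)𝒢(∂*A) A exp(−½‖∂A‖²), (4.4.2)"*.  [6I] p. 34: *"so finally we get the representation H_kB = GQ*(QGQ*)⁻¹B. (1.103)"*.

CITATION HEADER (lean-in-tree rule).  Part of the lit-balaban TYPED SKELETON (HOME `run/shared/lean/pub/lit-balaban/`), Phase-2 seat p09 gen 5;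
row **C1.Eq7.2.1-7.2.2** of `HOME/SKELETON.md` (typed `…BIJ85Sect7Statements.KernelData.Ineq722` p239582; owner r15, referee ref-5; ROWS cell
«proved p251888 + p251020 + p252478 + p255270 (F2: for the printed G = Δ_a⁻¹, given only B5.Prop12Printed)»).  Decls of record used BY NAME
(nothing restated): p16's `B5Eq147TorusBridge.Hk_opsV1_apply` ((4.4.2) on V1 = (1.63) on the tower, `B5HkOpLandauMin.hkT`,
`B5TowerOneStroke.pullR`), `B5Hk163Form166.HkOp_eq_Hk` ((1.63) = (1.103)), `Beta.FluctuationProjection.Hk/QGQ/QGQ_mul_inv` ((1.103)),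
`B5RealFields` (reality of `Q_k`, `Q_k^*`, `Δ_a⁻¹`; `IsReal.reM_inv`), `B5DeltaA169.calG_eq_DeltaA_inv`, file 4's `Q_apply_eq_QvOp`, file 1's
`Rep103.H_apply/gradH_apply`, p08's `BIJ85Ineq724Proof.applyKernel/Dk/eq724_repr`.

WHAT IS PROVED (kernel; standing range `k ≤ m + K`; `n = L^k`, `Mk P k = (sitesPerDir k)_μ`, `EK : Site P 0 ≃ Tor (fine (L^k) (Mk P k))`, `Site P k`
IS `Tor (Mk P k)`; any `a > 0`; `Site` written `Balaban1983to89.Site`):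
* §1 `isReal_calG/QGQ/QGQ_inv/Hk/HkOp` — `G = Δ_a⁻¹`, `QGQ^*`, `(QGQ^*)⁻¹`, `H_k = GQ^*(QGQ^*)⁻¹` and the (1.63) operator have REAL kernels.
* §2 THE DICTIONARY, entry by entry, between the torus datum `R = torusRep P k (deltaAData hk a)` of file 4 and the tree's [6I] operators:
  `G_coe` (`R.G` = `Δ_a⁻¹` along `EK`), `Q_coe` (`R.Q` = `B5Block118.QvOp`), `Qs_coe` (`R.Q^*` = `B5DeltaA169.QvAdj`), `M_coe` (`R.M = QGQ^*` =
  `Beta.FluctuationProjection.QGQ`), `K_coe` (`R.K = (QGQ^*)⁻¹`), and **`H_coe`/`H_eq_re`/`H_coe_HkOp`: `H((x,μ),(y,ν)) = H_k((EK x, μ),(y, ν))`** —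
  the kernel of the row's torus instance IS the kernel of (1.103) = (1.63); `H_indep` (independent of `a`); `gradH_eq`/`torusKernelData_gradH`
  (the `∇H` kernel is the forward difference quotient `L^k(H((x + ηe_λ, μ), ·) − H((x, μ), ·))` of the `H` kernel).
* §3 **(7.2.1)**: `HkOp_mulVec_eq` (for the (1.63)/(1.103) operator on the one-stroke torus, every complex `B′`), `hkT_eq` (on the tower), and
  **`eq721`: `(H_kB)(⟨x, μ⟩) = Σ_{y∈T^{(k)}} Σ_ν H((x,μ),(y,ν))·B(⟨y, ν⟩)` FOR THE (4.4.2) LANDAU GAUGE MINIMIZER `BIJ85LandauMinimizer442.Hk (opsV1 P k c s)`**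
  (every `c, s ≠ 0`), `eq721_rep103` (the same with the kernel written `Re (GQ^*(QGQ^*)⁻¹)((EK x,μ),(y,ν))`), `eq721_applyKernel` (p08's
  `applyKernel` form), `torusKernelData_H` (the `H` member of the Sect. 7.2 carrier is this kernel).
* §4 CONSEQUENCES: `eq724_repr_minimizer` — (7.2.4)'s first clause `λ(x) = (D_kB)(x) = Σ_b D_k(x,b)B(b)` for the gauge function (5.1.13) OF THE
  ACTUAL MINIMIZER `H_kB`, `D_k = Dk c′ k H_k`; `sect72_eq721_ineq722` — for the family of scales `lev k ≤ m + K`: (7.2.1) for the (4.4.2) minimizers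
  AND (7.2.2) `KernelData.Ineq722` for the same kernel family, GIVEN ONLY [6I] Proposition 1.2 by its tree name `B5.Prop12Printed` (file 4).
HONEST SCOPE.  (i) Exactly as in file 4, [6I] Proposition 1.2 remains the hypothesis of (7.2.2) (not of (7.2.1), which is unconditional).
(ii) `U = 1` (pure-Maxwell minimizers of [6I] Sect. 1 / [BalabanImbrieJaffe1985] Sects. 4–5, real abelian fields); torus (periodic b.c.).
(iii) No new definition, no `def … : Prop`, no hypothesis bundle: theorems only.  Unit `lit-balaban-p09` (literature-prover-lit-balaban-p09-g5-0), 2026-08-21.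
-/


namespace Literature.MathematicalPhysics.QuantumFieldTheory.BalabanImbrieJaffe1984to88.BIJ85Eq721MinimizerKernel

open Literature.MathematicalPhysics.QuantumFieldTheory.Balaban1983to89
open scoped BigOperators Matrix ComplexConjugate ComplexOrder
open LatticeFieldCalculus
open BIJ85Ineq722Proof BIJ85Ineq722Proof.Rep103 BIJ85Ineq722ProofPart2 BIJ85Sect7Statements BIJ85Ineq722Torus
open BIJ85Ineq722DeltaA (Gk DGk deltaAData Q_apply_eq_QvOp)
open BIJ85Ineq724Proof (Dk applyKernel eq724_repr)
open B5Prop11Plancherel (Tor fine calG)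
open B5Block118 (QvOp)
open B5DeltaA169 (QvAdj DeltaA calG_eq_DeltaA_inv)
open B5Eq117TorusCarriers (Mk EK eK tB tB_apply eBondK)
open B5TowerOneStroke (towerE pullR pullR_apply)
open B5Hk163Torus (HkOp)
open B5Hk163Form166 (HkOp_eq_Hk)
open B5HkOpLandauMin (hkT hkT_def)
open B5Eq147TorusBridge (Hk_opsV1_apply)
open B5RealFields (IsReal reM isReal_QvOp isReal_QvAdj isReal_DeltaA_inv)
open Beta (FluctuationProjection.QGQ FluctuationProjection.Hk FluctuationProjection.QGQ_mul_inv)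
open BIJ85LandauMinimizer442V1 (opsV1)

noncomputable section

/-! ## §1  Reality of the [6I] operators `G = Δ_a⁻¹`, `QGQ*`, `(QGQ*)⁻¹`, `H_k = GQ*(QGQ*)⁻¹` -/

section Real

variable {d : ℕ} (n : ℕ) [NeZero n] (hn : 1 ≤ n) (M : Fin d → ℕ) [hM : ∀ μ, NeZero (M μ)] (a : ℝ) (ha : 0 < a)

/-- `G = Δ_a⁻¹` is a real operator. [cite: Balaban1984PropagatorsI, (1.71) p.30] -/
theorem isReal_calG : IsReal (calG n hn M a ha) := by
  rw [calG_eq_DeltaA_inv]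
  exact isReal_DeltaA_inv n M a

/-- `QGQ*` is a real operator. [cite: Balaban1984PropagatorsI, (1.102) p.34] -/
theorem isReal_QGQ : IsReal (FluctuationProjection.QGQ n hn M a ha) :=
  ((isReal_QvOp n M).mul (isReal_calG n hn M a ha)).mul (isReal_QvAdj n M)

/-- `(QGQ*)⁻¹` is a real operator. [cite: Balaban1984PropagatorsI, (1.102) p.34] -/
theorem isReal_QGQ_inv : IsReal (FluctuationProjection.QGQ n hn M a ha)⁻¹ :=
  (isReal_QGQ n hn M a ha).inv

/-- **`H_k = GQ*(QGQ*)⁻¹` (1.103) is a real operator** (its kernel `H_{k,μν}(x; y)` is real). [cite: Balaban1984PropagatorsI, (1.103) p.34] -/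
theorem isReal_Hk : IsReal (FluctuationProjection.Hk n hn M a ha) :=
  ((isReal_calG n hn M a ha).mul (isReal_QvAdj n M)).mul (isReal_QGQ_inv n hn M a ha)

/-- the (1.63) operator `H_k` is real (it equals (1.103), `B5Hk163Form166.HkOp_eq_Hk`). [cite: Balaban1984PropagatorsI, (1.63) p.28] -/
theorem isReal_HkOp : IsReal (HkOp n M) := by
  have hn' : 1 ≤ n := Nat.one_le_iff_ne_zero.mpr (NeZero.ne n)
  rw [HkOp_eq_Hk n hn' M 1 one_pos]
  exact isReal_Hk n hn' M 1 one_pos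

end Real

/-! ## §2  The kernels of row C1.Eq7.2.1-7.2.2's torus instance ARE the kernels of the [6I] operators -/

variable {P : Params} {k : ℕ}

/-- `n^d·η^d = 1` in `ℂ` (`η = L^{−k}`, `n = L^k`). [folklore] -/
private theorem npow_mul_etapow (k : ℕ) : (((P.L ^ k : ℕ) : ℂ)) ^ P.d * ((P.eta k : ℝ) : ℂ) ^ P.d = 1 := by
  have hL : (P.L : ℂ) ≠ 0 := Nat.cast_ne_zero.mpr P.L_pos.ne'
  unfold Params.eta
  push_cast
  rw [← mul_pow, ← mul_pow, mul_inv_cancel₀ hL, one_pow, one_pow]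

/-- **`G`**: the kernel `G` of the torus datum is the kernel of `Δ_a⁻¹` (reindexed along `EK`; real entries).
[cite: Balaban1984PropagatorsI, (1.71) p.30] -/
theorem G_coe (hk : k ≤ P.m + P.K) (a : ℝ) (i j : Balaban1983to89.Site P 0 × Fin P.d) :
    (((torusRep P k (deltaAData hk a)).G i j : ℝ) : ℂ) = (DeltaA (P.L ^ k) (Mk P k) a)⁻¹ (EK hk i.1, i.2) (EK hk j.1, j.2) :=
  (isReal_DeltaA_inv (P.L ^ k) (Mk P k) a).coe_reM _ _

/-- **`Q`**: the kernel `Q = η^d(Q^*)ᵀ` of the torus datum is the kernel of `B5Block118.QvOp` (F2's `Q_apply_eq_QvOp`).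
[cite: Balaban1984PropagatorsI, (1.18) p.20] -/
theorem Q_coe (hk : k ≤ P.m + P.K) (a : ℝ) (p : Balaban1983to89.Site P k × Fin P.d) (i : Balaban1983to89.Site P 0 × Fin P.d) :
    (((torusRep P k (deltaAData hk a)).Q p i : ℝ) : ℂ) = QvOp (P.L ^ k) (Mk P k) p (EK hk i.1, i.2) :=
  Q_apply_eq_QvOp hk (Gk hk a) (DGk hk a) p i

/-- **`Q^*`**: the kernel `Q^* = QsStd` of the torus datum is the kernel of `B5DeltaA169.QvAdj` (`Q^* = n^dQᴴ`, `Q = η^d(Q^*)ᵀ`, `n^dη^d = 1`).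
[cite: Balaban1984PropagatorsI, (1.21) p.21] -/
theorem Qs_coe (hk : k ≤ P.m + P.K) (a : ℝ) (j : Balaban1983to89.Site P 0 × Fin P.d) (p : Balaban1983to89.Site P k × Fin P.d) :
    (((torusRep P k (deltaAData hk a)).Qs j p : ℝ) : ℂ) = QvAdj (P.L ^ k) (Mk P k) (EK hk j.1, j.2) p := by
  -- `Q^*((x,μ),p) = n^d · conj Q(p,(x,μ))` and `Q(p,(x,μ)) = η^d·Q^*((x,μ),p)` (`torusRep_std_Q_apply`), `n^dη^d = 1`
  have hQ : (torusRep P k (deltaAData hk a)).Q p j = P.eta k ^ P.d * (torusRep P k (deltaAData hk a)).Qs j p := rfl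
  rw [QvAdj, Matrix.smul_apply, Matrix.conjTranspose_apply, ← Q_coe hk a p j, Complex.star_def, Complex.conj_ofReal, smul_eq_mul,
    hQ, Complex.ofReal_mul, ← mul_assoc, Complex.ofReal_pow, npow_mul_etapow, one_mul]

/-- **`QGQ*`**: the unit-lattice operator `M = QGQ^*` of the torus datum is `Beta.FluctuationProjection.QGQ` for `G = Δ_a⁻¹`.
[cite: Balaban1984PropagatorsI, (1.102) p.34] -/
theorem M_coe (hk : k ≤ P.m + P.K) {a : ℝ} (ha : 0 < a) (p p' : Balaban1983to89.Site P k × Fin P.d) :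
    (((torusRep P k (deltaAData hk a)).M p p' : ℝ) : ℂ)
      = FluctuationProjection.QGQ (P.L ^ k) (Nat.one_le_pow k P.L P.L_pos) (Mk P k) a ha p p' := by
  let e : Balaban1983to89.Site P 0 × Fin P.d ≃ Tor (fine (P.L ^ k) (Mk P k)) × Fin P.d := (EK hk).prodCongr (Equiv.refl _)
  have he : ∀ j : Balaban1983to89.Site P 0 × Fin P.d, e j = (EK hk j.1, j.2) := fun j => rfl
  simp only [Rep103.M, Matrix.mul_apply]
  push_cast
  simp only [Q_coe hk a, G_coe hk a, Qs_coe hk a]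
  rw [FluctuationProjection.QGQ, calG_eq_DeltaA_inv]
  simp only [Matrix.mul_apply]
  refine Fintype.sum_equiv e _ _ fun j => ?_
  rw [he j]
  congr 1
  exact Fintype.sum_equiv e _ _ fun i => by rw [he i]

/-- **`(QGQ*)⁻¹`**: `K = (QGQ^*)⁻¹` of the torus datum is `(Beta.FluctuationProjection.QGQ)⁻¹` (a real matrix: `B5RealFields.IsReal.reM_inv`).
[cite: Balaban1984PropagatorsI, (1.102) p.34] -/
theorem K_coe (hk : k ≤ P.m + P.K) {a : ℝ} (ha : 0 < a) (p p' : Balaban1983to89.Site P k × Fin P.d) :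
    (((torusRep P k (deltaAData hk a)).K p p' : ℝ) : ℂ)
      = (FluctuationProjection.QGQ (P.L ^ k) (Nat.one_le_pow k P.L P.L_pos) (Mk P k) a ha)⁻¹ p p' := by
  have hM : (torusRep P k (deltaAData hk a)).M = reM (FluctuationProjection.QGQ (P.L ^ k) (Nat.one_le_pow k P.L P.L_pos) (Mk P k) a ha) := by
    ext q q'
    apply Complex.ofReal_injective
    rw [M_coe hk ha q q']
    exact ((isReal_QGQ (P.L ^ k) (Nat.one_le_pow k P.L P.L_pos) (Mk P k) a ha).coe_reM q q').symm
  have hK : (torusRep P k (deltaAData hk a)).K = reM (FluctuationProjection.QGQ (P.L ^ k) (Nat.one_le_pow k P.L P.L_pos) (Mk P k) a ha)⁻¹ := by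
    show ((torusRep P k (deltaAData hk a)).M)⁻¹ = _
    rw [hM]
    exact (isReal_QGQ (P.L ^ k) (Nat.one_le_pow k P.L P.L_pos) (Mk P k) a ha).reM_inv
      (FluctuationProjection.QGQ_mul_inv (P.L ^ k) (Nat.one_le_pow k P.L P.L_pos) (Mk P k) a ha)
  rw [hK]
  exact (isReal_QGQ_inv (P.L ^ k) (Nat.one_le_pow k P.L P.L_pos) (Mk P k) a ha).coe_reM p p'

/-- **THE KERNEL `H_{k,μν}(x; y)` OF ROW C1.Eq7.2.1-7.2.2's TORUS INSTANCE IS THE KERNEL OF `H_k = GQ*(QGQ*)⁻¹` (1.103)** for `G = Δ_a⁻¹`: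
`H((x,μ),(y,ν)) = H_k((EK x, μ), (y, ν))` (the tree's `Beta.FluctuationProjection.Hk`; real entries).
[cite: Balaban1984PropagatorsI, (1.103) p.34] -/
theorem H_coe (hk : k ≤ P.m + P.K) {a : ℝ} (ha : 0 < a) (i : Balaban1983to89.Site P 0 × Fin P.d)
    (p : Balaban1983to89.Site P k × Fin P.d) :
    (((torusRep P k (deltaAData hk a)).H i p : ℝ) : ℂ)
      = FluctuationProjection.Hk (P.L ^ k) (Nat.one_le_pow k P.L P.L_pos) (Mk P k) a ha (EK hk i.1, i.2) p := by
  let e : Balaban1983to89.Site P 0 × Fin P.d ≃ Tor (fine (P.L ^ k) (Mk P k)) × Fin P.d := (EK hk).prodCongr (Equiv.refl _)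
  have he : ∀ j : Balaban1983to89.Site P 0 × Fin P.d, e j = (EK hk j.1, j.2) := fun j => rfl
  simp only [Rep103.H, Matrix.mul_apply]
  push_cast
  simp only [G_coe hk a, Qs_coe hk a, K_coe hk ha]
  rw [FluctuationProjection.Hk, calG_eq_DeltaA_inv]
  simp only [Matrix.mul_apply]
  refine Fintype.sum_equiv (Equiv.refl _) _ _ fun p' => ?_
  rw [Equiv.refl_apply]
  congr 1
  exact Fintype.sum_equiv e _ _ fun j => by rw [he j]

/-- the same, real form: `H((x,μ),(y,ν)) = Re H_k((EK x, μ), (y, ν))`. [cite: Balaban1984PropagatorsI, (1.103) p.34] -/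
theorem H_eq_re (hk : k ≤ P.m + P.K) {a : ℝ} (ha : 0 < a) (i : Balaban1983to89.Site P 0 × Fin P.d)
    (p : Balaban1983to89.Site P k × Fin P.d) :
    (torusRep P k (deltaAData hk a)).H i p
      = (FluctuationProjection.Hk (P.L ^ k) (Nat.one_le_pow k P.L P.L_pos) (Mk P k) a ha (EK hk i.1, i.2) p).re := by
  rw [← H_coe hk ha i p, Complex.ofReal_re]

/-- the same through the (1.63) operator `B5Hk163Torus.HkOp` (= (1.103), `B5Hk163Form166.HkOp_eq_Hk`): `H((x,μ),p) = H_k^{(1.63)}((EK x, μ), p)`.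
[cite: Balaban1984PropagatorsI, (1.63) p.28] -/
theorem H_coe_HkOp (hk : k ≤ P.m + P.K) {a : ℝ} (ha : 0 < a) (i : Balaban1983to89.Site P 0 × Fin P.d)
    (p : Balaban1983to89.Site P k × Fin P.d) :
    (((torusRep P k (deltaAData hk a)).H i p : ℝ) : ℂ) = HkOp (P.L ^ k) (Mk P k) (EK hk i.1, i.2) p := by
  rw [H_coe hk ha, HkOp_eq_Hk (P.L ^ k) (Nat.one_le_pow k P.L P.L_pos) (Mk P k) a ha]

/-- **the kernel `H_{k,μν}` does not depend on `a`** ([6I] p. 34: `H_kB = GQ^*(QGQ^*)⁻¹B` solves the `a`-independent variational problem;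
in the tree both equal the (1.63) kernel). [cite: Balaban1984PropagatorsI, (1.103) p.34] -/
theorem H_indep (hk : k ≤ P.m + P.K) {a a' : ℝ} (ha : 0 < a) (ha' : 0 < a') :
    (torusRep P k (deltaAData hk a)).H = (torusRep P k (deltaAData hk a')).H := by
  ext i p
  apply Complex.ofReal_injective
  rw [H_coe_HkOp hk ha, H_coe_HkOp hk ha']

/-- **the gradient kernel `∇H_{k,μν}(x, y)` of the torus instance is the forward difference quotient of the kernel `H_{k,μν}(·, y)`**:
`∇H((x,λ,μ),(y,ν)) = L^k·(H((x + ηe_λ, μ),(y,ν)) − H((x,μ),(y,ν)))` ([6I] (1.4), `η = L^{−k}`). [cite: BalabanImbrieJaffe1985, (7.2.2) p.325] -/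
theorem gradH_eq (hk : k ≤ P.m + P.K) (a : ℝ) (x : Balaban1983to89.Site P 0) (lam μ : Fin P.d)
    (p : Balaban1983to89.Site P k × Fin P.d) :
    (torusRep P k (deltaAData hk a)).gradH (x, lam, μ) p
      = (P.L : ℝ) ^ k * ((torusRep P k (deltaAData hk a)).H (x.shift lam, μ) p - (torusRep P k (deltaAData hk a)).H (x, μ) p) := by
  have hDG : ∀ j : Balaban1983to89.Site P 0 × Fin P.d, (torusRep P k (deltaAData hk a)).DG (x, lam, μ) j
      = (P.L : ℝ) ^ k * ((torusRep P k (deltaAData hk a)).G (x.shift lam, μ) j - (torusRep P k (deltaAData hk a)).G (x, μ) j) :=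
    fun j => rfl
  rw [gradH_apply, H_apply, H_apply]
  simp only [Matrix.mulVec, dotProduct, hDG]
  rw [← Finset.sum_sub_distrib, Finset.mul_sum]
  exact Finset.sum_congr rfl fun j _ => by ring

/-- the `|∇H_{k,μν}(x, y)|` member of the Sect. 7.2 carrier of the torus instance is the (sup over `λ` of the) forward difference quotient of
`H_{k,μν}(·, y)`: `gradH μ ν x y = ‖λ ↦ L^k(H_{k,μν}(x + ηe_λ; y) − H_{k,μν}(x; y))‖`. [cite: BalabanImbrieJaffe1985, (7.2.2) p.325] -/
theorem torusKernelData_gradH (hk : k ≤ P.m + P.K) (a : ℝ) (BondU : Type) (distEB : Balaban1983to89.Site P 0 → BondU → ℝ)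
    (Cker : Fin P.d → Fin P.d → Balaban1983to89.Site P k → Balaban1983to89.Site P k → ℝ) (Dker : Balaban1983to89.Site P 0 → BondU → ℝ)
    (μ ν : Fin P.d) (x : Balaban1983to89.Site P 0) (y : Balaban1983to89.Site P k) :
    (torusKernelData P k (deltaAData hk a) BondU distEB Cker Dker).gradH μ ν x y
      = ‖fun lam : Fin P.d => (P.L : ℝ) ^ k *
          ((torusRep P k (deltaAData hk a)).H (x.shift lam, μ) (y, ν) - (torusRep P k (deltaAData hk a)).H (x, μ) (y, ν))‖ := by
  show ‖fun lam : Fin P.d => (torusRep P k (deltaAData hk a)).gradH (x, lam, μ) (y, ν)‖ = _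
  simp only [gradH_eq]

/-! ## §3  (7.2.1): `(H_kB)_μ(x) = Σ_{y,ν} H_{k,μν}(x; y)B_ν(y)` — for (1.63)/(1.103) on the torus, on the tower, and for the (4.4.2) minimizer -/

/-- **(7.2.1) for Bałaban's operator `H_k` ((1.63) = (1.103)) on the one-stroke torus**: for every (complex) unit-lattice field `B′`,
`(H_kB′)(EK x, μ) = Σ_p H((x,μ), p)·B′(p)` with the kernel `H` of the torus instance. [cite: BalabanImbrieJaffe1985, (7.2.1) p.325] -/
theorem HkOp_mulVec_eq (hk : k ≤ P.m + P.K) {a : ℝ} (ha : 0 < a) (B' : Tor (Mk P k) × Fin P.d → ℂ)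
    (x : Balaban1983to89.Site P 0) (μ : Fin P.d) :
    (HkOp (P.L ^ k) (Mk P k) *ᵥ B') (EK hk x, μ)
      = ∑ p : Tor (Mk P k) × Fin P.d, (((torusRep P k (deltaAData hk a)).H (x, μ) p : ℝ) : ℂ) * B' p := by
  rw [HkOp_eq_Hk (P.L ^ k) (Nat.one_le_pow k P.L P.L_pos) (Mk P k) a ha]
  simp only [Matrix.mulVec, dotProduct, H_coe hk ha]

/-- **(7.2.1) on the tower** (`B5HkOpLandauMin.hkT`, the Landau minimiser of [6I] p. 26 transported): `(H_kB′)(eK x, μ) = Σ_p H((x,μ),p)·B′(p)`.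
[cite: BalabanImbrieJaffe1985, (7.2.1) p.325] -/
theorem hkT_eq (hk : k ≤ P.m + P.K) {a : ℝ} (ha : 0 < a) (B' : B5SectBStatements.Fld (Mk P k))
    (x : Balaban1983to89.Site P 0) (μ : Fin P.d) :
    hkT P.L (Mk P k) k B' (eK hk x, μ) = ∑ p : Tor (Mk P k) × Fin P.d, (torusRep P k (deltaAData hk a)).H (x, μ) p * B' p := by
  rw [hkT_def, pullR_apply]
  show ((HkOp (P.L ^ k) (Mk P k) *ᵥ B5SectBStatements.cplx B') (EK hk x, μ)).re = _
  rw [HkOp_mulVec_eq hk ha, Complex.re_sum]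
  refine Finset.sum_congr rfl fun p _ => ?_
  show ((((torusRep P k (deltaAData hk a)).H (x, μ) p : ℝ) : ℂ) * ((B' p : ℝ) : ℂ)).re = _
  rw [← Complex.ofReal_mul, Complex.ofReal_re]

/-- **(7.2.1) FOR THE LANDAU GAUGE MINIMIZER `H_k` OF (4.4.2)** p. 312 (`BIJ85LandauMinimizer442.Hk` on the V1 lattice calculus,
`BIJ85LandauMinimizer442V1.opsV1`; any lattice factor `c ≠ 0` and weight `s ≠ 0`), p. 325 verbatim: *"The minimizer H_k can be expressed as
an integral kernel. For x ∈ T_η, (H_kB)_μ(x) = Σ_{y∈T₁^{(k)},ν} H_{k,μν}(x; y)B_ν(y). (7.2.1)"* — with `H_{k,μν}(x; y)` THE KERNEL OF ROW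
C1.Eq7.2.1-7.2.2's TORUS INSTANCE for the printed `G = Δ_a⁻¹` (`(torusRep P k (deltaAData hk a)).H (x,μ) (y,ν)`, for which (7.2.2) is the tree's
`BIJ85Ineq722DeltaA.ineq722_deltaA`); via p16's `B5Eq147TorusBridge.Hk_opsV1_apply` ((4.4.2) = (1.63)) and `B5Hk163Form166.HkOp_eq_Hk`
((1.63) = (1.103)); standing range `k ≤ m + K`, any `a > 0`. [cite: BalabanImbrieJaffe1985, (7.2.1) p.325] -/
theorem eq721 (hk : k ≤ P.m + P.K) {a : ℝ} (ha : 0 < a) {c s : ℝ} (hc : c ≠ 0) (hs : s ≠ 0) (B : VecField P k ℝ)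
    (x : Balaban1983to89.Site P 0) (μ : Fin P.d) :
    BIJ85LandauMinimizer442.Hk (opsV1 P k c s) B ⟨x, μ⟩
      = ∑ y : Balaban1983to89.Site P k, ∑ ν : Fin P.d, (torusRep P k (deltaAData hk a)).H (x, μ) (y, ν) * B ⟨y, ν⟩ := by
  rw [Hk_opsV1_apply hk hc hs B ⟨x, μ⟩]
  show hkT P.L (Mk P k) k (tB B) (eK hk x, μ) = _
  rw [hkT_eq hk ha, Fintype.sum_prod_type]
  rfl

/-- **(7.2.1) with the kernel written as [6I] (1.103)**: `(H_kB)_μ(x) = Σ_{y,ν} Re (GQ^*(QGQ^*)⁻¹)((EK x, μ), (y, ν))·B_ν(y)` for the (4.4.2)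
minimizer (`Beta.FluctuationProjection.Hk`; the entries are real, `isReal_Hk`). [cite: BalabanImbrieJaffe1985, (7.2.1) p.325] -/
theorem eq721_rep103 (hk : k ≤ P.m + P.K) {a : ℝ} (ha : 0 < a) {c s : ℝ} (hc : c ≠ 0) (hs : s ≠ 0) (B : VecField P k ℝ)
    (x : Balaban1983to89.Site P 0) (μ : Fin P.d) :
    BIJ85LandauMinimizer442.Hk (opsV1 P k c s) B ⟨x, μ⟩
      = ∑ y : Balaban1983to89.Site P k, ∑ ν : Fin P.d,
          (FluctuationProjection.Hk (P.L ^ k) (Nat.one_le_pow k P.L P.L_pos) (Mk P k) a ha (EK hk x, μ) (y, ν)).re * B ⟨y, ν⟩ := by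
  rw [eq721 hk ha hc hs B x μ]
  simp only [H_eq_re hk ha]
  rfl

/-- (7.2.1) in the `applyKernel` form of `BIJ85Ineq724Proof` (the kernel indexed as `KernelData.H`: `μ ν x y`): the (4.4.2) minimizer IS
`applyKernel k H_k B`. [cite: BalabanImbrieJaffe1985, (7.2.1) p.325] -/
theorem eq721_applyKernel (hk : k ≤ P.m + P.K) {a : ℝ} (ha : 0 < a) {c s : ℝ} (hc : c ≠ 0) (hs : s ≠ 0) (B : VecField P k ℝ)
    (b : PBond P 0) :
    BIJ85LandauMinimizer442.Hk (opsV1 P k c s) B b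
      = applyKernel k (fun μ ν x y => (torusRep P k (deltaAData hk a)).H (x, μ) (y, ν)) B b := by
  obtain ⟨x, μ⟩ := b
  rw [eq721 hk ha hc hs B x μ, applyKernel, ← Finset.sum_product']
  refine Fintype.sum_equiv (bondEquiv (P := P) (j := k)) _ _ fun q => rfl

/-- the kernel `H` of the Sect. 7.2 carrier `torusKernelData` of the torus instance is `H_{k,μν}(x; y) = H((x,μ),(y,ν))` (unfolding).
[cite: BalabanImbrieJaffe1985, (7.2.1) p.325] -/
theorem torusKernelData_H (D : TorusData P k) (BondU : Type) (distEB : Balaban1983to89.Site P 0 → BondU → ℝ)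
    (Cker : Fin P.d → Fin P.d → Balaban1983to89.Site P k → Balaban1983to89.Site P k → ℝ) (Dker : Balaban1983to89.Site P 0 → BondU → ℝ)
    (μ ν : Fin P.d) (x : Balaban1983to89.Site P 0) (y : Balaban1983to89.Site P k) :
    (torusKernelData P k D BondU distEB Cker Dker).H μ ν x y = (torusRep P k D).H (x, μ) (y, ν) := rfl

/-! ## §4  Consequences: (7.2.4)'s `λ(x) = (D_kB)(x)` for the actual minimizer; Sect. 7.2's first paragraph for the (4.4.2) minimizer -/

/-- **(7.2.4), first clause, FOR THE ACTUAL MINIMIZER**: the gauge function (5.1.4)/(5.1.13) of `H_kB` is `λ(x) = Σ_b D_k(x, b)·B(b)` with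
`D_k = BIJ85Ineq724Proof.Dk c′ k H_k` the kernel computed from `H_{k,μν}` (p08's `eq724_repr` at the (4.4.2) minimizer).
[cite: BalabanImbrieJaffe1985, (7.2.4) p.326] -/
theorem eq724_repr_minimizer (hk : k ≤ P.m + P.K) {a : ℝ} (ha : 0 < a) {c s : ℝ} (hc : c ≠ 0) (hs : s ≠ 0) (c' : ℝ)
    (B : VecField P k ℝ) (x : Balaban1983to89.Site P 0) :
    BIJ85GaugeFunction5113.lamOf c' k (fun b => BIJ85LandauMinimizer442.Hk (opsV1 P k c s) B b) x
      = ∑ b : PBond P k, Dk c' k (fun μ ν x y => (torusRep P k (deltaAData hk a)).H (x, μ) (y, ν)) x b * B b := by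
  have h : (fun b => BIJ85LandauMinimizer442.Hk (opsV1 P k c s) B b)
      = applyKernel k (fun μ ν x y => (torusRep P k (deltaAData hk a)).H (x, μ) (y, ν)) B :=
    funext fun b => eq721_applyKernel hk ha hc hs B b
  rw [h, eq724_repr]

/-- **SECT. 7.2, (7.2.1)–(7.2.2), FOR THE (4.4.2) MINIMIZER ON THE TORUS**: for the family of scales `lev k ≤ m + K`, the kernel family
`H_{k,μν}` of the torus instances for the printed `G = Δ_a⁻¹` satisfies BOTH (7.2.1) — it is the integral kernel of the Landau gauge minimizer
`H_k` of (4.4.2) — AND (7.2.2) `KernelData.Ineq722` (F2's `ineq722_deltaA_of_prop12Printed`), GIVEN ONLY [6I] Proposition 1.2 by its tree name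
`B5.Prop12Printed`. [cite: BalabanImbrieJaffe1985, (7.2.1)–(7.2.2) p.325] -/
theorem sect72_eq721_ineq722 (lev : ℕ → ℕ) (hlev : ∀ k, lev k ≤ P.m + P.K) {a : ℝ} (ha : 0 < a) {c s : ℝ} (hc : c ≠ 0) (hs : s ≠ 0)
    (BondU : ℕ → Type) (distEB : (k : ℕ) → Balaban1983to89.Site P 0 → BondU k → ℝ)
    (Cker : (k : ℕ) → Fin P.d → Fin P.d → Balaban1983to89.Site P (lev k) → Balaban1983to89.Site P (lev k) → ℝ)
    (Dker : (k : ℕ) → Balaban1983to89.Site P 0 → BondU k → ℝ)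
    (h12 : B5.Prop12Printed (fun k => settingOf (torusRep P (lev k) (deltaAData (hlev k) a)) k)) :
    (∀ (k : ℕ) (B : VecField P (lev k) ℝ) (x : Balaban1983to89.Site P 0) (μ : Fin P.d),
        BIJ85LandauMinimizer442.Hk (opsV1 P (lev k) c s) B ⟨x, μ⟩
          = ∑ y : Balaban1983to89.Site P (lev k), ∑ ν : Fin P.d,
              (torusKernelData P (lev k) (deltaAData (hlev k) a) (BondU k) (distEB k) (Cker k) (Dker k)).H μ ν x y * B ⟨y, ν⟩) ∧
      KernelData.Ineq722 (fun k => torusKernelData P (lev k) (deltaAData (hlev k) a) (BondU k) (distEB k) (Cker k) (Dker k)) :=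
  ⟨fun k B x μ => eq721 (hlev k) ha hc hs B x μ,
    BIJ85Ineq722DeltaA.ineq722_deltaA_of_prop12Printed lev hlev ha BondU distEB Cker Dker h12⟩

/-! ## §5  (7.2.4) for the gauge transformation `λ` of (5.1.1) ITSELF (v1.1, append-only)

p. 326, verbatim: *"The gauge transformation λ in (5.1.1) is bounded and depends on B through an exponentially decaying kernel D_k: λ(x) =
(D_kB)(x), |D_k(x, b)| ≤ Me^{−δdist(x,b)}. (7.2.4) This estimate follows from (5.1.4) and (7.2.2)."*  With (7.2.1) for the (4.4.2) minimizer
(§3) the three printed clauses hold for THE ACTUAL OBJECTS of Proposition 5.1.1 on the torus: the axial gauge minimizer `H_{k,Ax}` (4.1.3)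
(`BIJ85AxialMinimizer413.torusHax`), the Landau gauge minimizer `H_k` (4.4.2) (`BIJ85LandauMinimizer442.Hk (opsV1 …)`), the gauge function
`λ = λ_k(H_kB)` of (5.1.4)/(5.1.13) (`BIJ85GaugeFunction5113.lamOf`) at the printed lattice factor `c = η⁻¹ = L^k`, and the kernel
`D_k = BIJ85Ineq724Proof.Dk (L^k) k H_k` — by NAME from p30/p09's `BIJ85Prop511Torus.prop511_torus` ((5.1.1)), §4's `eq724_repr_minimizer`
(λ = D_kB) and file 4's `BIJ85Ineq724Torus.ineq724_torusKernelData`/`BIJ85Ineq722DeltaA.torusHyps_deltaA` (the decay, given [6I] Prop. 1.2). -/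

section Eq724Actual

open BIJ85Prop511Torus (prop511_torus)
open BIJ85AxialMinimizer413 (torusHax)
open BIJ85AxialPropagator411 (deltaAx)
open BIJ85GaugeFunction5113 (lamOf)
open BIJ85Ineq724Torus (ineq724_torusKernelData)
open BIJ85Ineq722DeltaA (torusHyps_deltaA ineq722_deltaA)
open T4GaugeActionRate (gam0)

/-- (7.2.1) as an identity of η-lattice bond functions: the (4.4.2) minimizer `H_kB` IS `applyKernel k H_k B` (p08's (7.2.1) operator).
[cite: BalabanImbrieJaffe1985, (7.2.1) p.325] -/
theorem ofLp_Hk_eq_applyKernel (hk : k ≤ P.m + P.K) {a : ℝ} (ha : 0 < a) {c s : ℝ} (hc : c ≠ 0) (hs : s ≠ 0) (B : VecField P k ℝ) :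
    WithLp.ofLp (BIJ85LandauMinimizer442.Hk (opsV1 P k c s) B)
      = applyKernel k (fun μ ν x y => (torusRep P k (deltaAData hk a)).H (x, μ) (y, ν)) B :=
  funext fun b => eq721_applyKernel hk ha hc hs B b

/-- **(7.2.4) FOR THE GAUGE TRANSFORMATION `λ` OF (5.1.1) ITSELF, on the torus at scale `k`** (printed lattice factor `c = L^k`; axial weight
`w > 0`; any `a > 0`): for every unit-lattice field `B` and every axial representative `A₀` (`Q_kA₀ = B`, `δ_{k,Ax}(A₀)`),
(5.1.1) `H_{k,Ax}B − H_kB = ∂λ` with `λ = λ_k(H_kB)`; `λ(x) = (D_kB)(x) = Σ_b D_k(x, b)B(b)` with `D_k = Dk (L^k) k H_k`, `H_k` the kernel of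
§2–§3; and `|D_k(x, b)| ≤ M·e^{−δ|x − b₋|}` with the `k`-INDEPENDENT constants `δ = rate722 …`, `M = d·const722·e^{δ/2}·e^{δ}` of file 4 — GIVEN
the three displayed members of [6I] Proposition 1.2 at this scale (`Prop12Hyps C Cα δ₀`). [cite: BalabanImbrieJaffe1985, (7.2.4) p.326] -/
theorem eq724_actual (hk : k ≤ P.m + P.K) {a : ℝ} (ha : 0 < a) {w : ℝ} (hw : 0 < w) {C δ₀ : ℝ} {Cα : ℝ → ℝ}
    (h12 : (torusRep P k (deltaAData hk a)).Prop12Hyps C Cα δ₀) {B : VecField P k ℝ} {A₀ : VecField P 0 ℝ}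
    (hQ : bondAvgIter k A₀ = B) (hax : deltaAx k A₀) :
    (torusHax w ((P.L : ℝ) ^ k) k A₀ - WithLp.ofLp (BIJ85LandauMinimizer442.Hk (opsV1 P k ((P.L : ℝ) ^ k) (Real.sqrt w)) B)
        = grad ((P.L : ℝ) ^ k)
          (lamOf ((P.L : ℝ) ^ k) k (WithLp.ofLp (BIJ85LandauMinimizer442.Hk (opsV1 P k ((P.L : ℝ) ^ k) (Real.sqrt w)) B)))) ∧
      (∀ x : Balaban1983to89.Site P 0,
        lamOf ((P.L : ℝ) ^ k) k (WithLp.ofLp (BIJ85LandauMinimizer442.Hk (opsV1 P k ((P.L : ℝ) ^ k) (Real.sqrt w)) B)) x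
          = ∑ b : PBond P k, Dk ((P.L : ℝ) ^ k) k (fun μ ν x y => (torusRep P k (deltaAData hk a)).H (x, μ) (y, ν)) x b * B b) ∧
      ∀ (x : Balaban1983to89.Site P 0) (b : PBond P k),
        |Dk ((P.L : ℝ) ^ k) k (fun μ ν x y => (torusRep P k (deltaAData hk a)).H (x, μ) (y, ν)) x b|
          ≤ P.d * (const722 P.d C δ₀ (gam0 P.d / (4 * P.d + a)) 1 1 1 (KYd P)
                * Real.exp (rate722 P.d C δ₀ (gam0 P.d / (4 * P.d + a)) 1 1 1 (KYd P) * (1 / 2))) *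
              Real.exp (rate722 P.d C δ₀ (gam0 P.d / (4 * P.d + a)) 1 1 1 (KYd P) * (1 / 2 + 1 / 2)) *
            Real.exp (-(rate722 P.d C δ₀ (gam0 P.d / (4 * P.d + a)) 1 1 1 (KYd P) * distEU P k x b.src)) :=
  have hc : ((P.L : ℝ) ^ k) ≠ 0 := pow_ne_zero _ (Nat.cast_ne_zero.mpr P.L_pos.ne')
  have hs : Real.sqrt w ≠ 0 := (Real.sqrt_pos.2 hw).ne'
  ⟨prop511_torus hk hc hw hQ hax,
    fun x => eq724_repr_minimizer hk ha hc hs ((P.L : ℝ) ^ k) B x,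
    fun x b => ineq724_torusKernelData hk (torusHyps_deltaA hk ha) h12 (fun _ _ _ _ => 0) x b⟩

/-- **SECT. 7.2, FIRST PARAGRAPH ((7.2.1), (7.2.2), (7.2.4)) FOR THE ACTUAL MINIMIZERS AND THE ACTUAL `λ` OF (5.1.1) ON THE TORUS**, for the
family of scales `lev k ≤ m + K` with `k`-independent constants, GIVEN at every scale the three displayed members of [6I] Proposition 1.2:
(7.2.1) for the (4.4.2) minimizers; (7.2.2) `KernelData.Ineq722` for the same kernels (file 4); and (7.2.4) in the form `eq724_actual`.
[cite: BalabanImbrieJaffe1985, (7.2.1)–(7.2.4) pp.325–326] -/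
theorem sect72_actual (lev : ℕ → ℕ) (hlev : ∀ k, lev k ≤ P.m + P.K) {a : ℝ} (ha : 0 < a) {w : ℝ} (hw : 0 < w)
    (Ck : (k : ℕ) → Fin P.d → Fin P.d → Balaban1983to89.Site P (lev k) → Balaban1983to89.Site P (lev k) → ℝ) {C δ₀ : ℝ} {Cα : ℝ → ℝ}
    (h12 : ∀ k, (torusRep P (lev k) (deltaAData (hlev k) a)).Prop12Hyps C Cα δ₀) :
    (∀ (k : ℕ) {c s : ℝ}, c ≠ 0 → s ≠ 0 → ∀ (B : VecField P (lev k) ℝ) (x : Balaban1983to89.Site P 0) (μ : Fin P.d),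
        BIJ85LandauMinimizer442.Hk (opsV1 P (lev k) c s) B ⟨x, μ⟩
          = ∑ y : Balaban1983to89.Site P (lev k), ∑ ν : Fin P.d, (torusRep P (lev k) (deltaAData (hlev k) a)).H (x, μ) (y, ν) * B ⟨y, ν⟩) ∧
      KernelData.Ineq722 (fun k => torusKernelData P (lev k) (deltaAData (hlev k) a) (PBond P (lev k))
        (fun x b => distEU P (lev k) x b.src) (Ck k)
        (Dk ((P.L : ℝ) ^ lev k) (lev k) (fun μ ν x y => (torusRep P (lev k) (deltaAData (hlev k) a)).H (x, μ) (y, ν)))) ∧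
      ∀ (k : ℕ) {B : VecField P (lev k) ℝ} {A₀ : VecField P 0 ℝ}, bondAvgIter (lev k) A₀ = B → deltaAx (lev k) A₀ →
        (torusHax w ((P.L : ℝ) ^ lev k) (lev k) A₀
              - WithLp.ofLp (BIJ85LandauMinimizer442.Hk (opsV1 P (lev k) ((P.L : ℝ) ^ lev k) (Real.sqrt w)) B)
            = grad ((P.L : ℝ) ^ lev k) (lamOf ((P.L : ℝ) ^ lev k) (lev k)
                (WithLp.ofLp (BIJ85LandauMinimizer442.Hk (opsV1 P (lev k) ((P.L : ℝ) ^ lev k) (Real.sqrt w)) B)))) ∧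
          (∀ x : Balaban1983to89.Site P 0,
            lamOf ((P.L : ℝ) ^ lev k) (lev k)
                (WithLp.ofLp (BIJ85LandauMinimizer442.Hk (opsV1 P (lev k) ((P.L : ℝ) ^ lev k) (Real.sqrt w)) B)) x
              = ∑ b : PBond P (lev k),
                  Dk ((P.L : ℝ) ^ lev k) (lev k) (fun μ ν x y => (torusRep P (lev k) (deltaAData (hlev k) a)).H (x, μ) (y, ν)) x b * B b) ∧
          ∀ (x : Balaban1983to89.Site P 0) (b : PBond P (lev k)),
            |Dk ((P.L : ℝ) ^ lev k) (lev k) (fun μ ν x y => (torusRep P (lev k) (deltaAData (hlev k) a)).H (x, μ) (y, ν)) x b|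
              ≤ P.d * (const722 P.d C δ₀ (gam0 P.d / (4 * P.d + a)) 1 1 1 (KYd P)
                    * Real.exp (rate722 P.d C δ₀ (gam0 P.d / (4 * P.d + a)) 1 1 1 (KYd P) * (1 / 2))) *
                  Real.exp (rate722 P.d C δ₀ (gam0 P.d / (4 * P.d + a)) 1 1 1 (KYd P) * (1 / 2 + 1 / 2)) *
                Real.exp (-(rate722 P.d C δ₀ (gam0 P.d / (4 * P.d + a)) 1 1 1 (KYd P) * distEU P (lev k) x b.src)) :=
  ⟨fun k _ _ hc hs B x μ => eq721 (hlev k) ha hc hs B x μ,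
    ineq722_deltaA lev hlev ha (fun k => PBond P (lev k)) (fun k x b => distEU P (lev k) x b.src) Ck
      (fun k => Dk ((P.L : ℝ) ^ lev k) (lev k) (fun μ ν x y => (torusRep P (lev k) (deltaAData (hlev k) a)).H (x, μ) (y, ν))) h12,
    fun k _ _ hQ hax => eq724_actual (hlev k) ha hw (h12 k) hQ hax⟩

end Eq724Actual

end

end Literature.MathematicalPhysics.QuantumFieldTheory.BalabanImbrieJaffe1984to88.BIJ85Eq721MinimizerKernel
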